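import Literature.Analysis.OperatorTheory.WeinsteinAronszajnPencil
import HarnessLib

/-!
# A real eigenvalue of a linear pencil inside a certified window, from a sign change of the
# Weinstein–Aronszajn determinant (`JiaSverakCAP.PencilEigenvalueWindow`)

HONEST FRAMING (audit cell `pub-nsjs`, papers/NavierStokesRegularity/ns-jia-sverak; seat B gen 15). This module is ABSTRACT
FUNCTIONAL ANALYSIS over a real normed space. It asserts NOTHING about the linearised Navier–Stokes operator `𝓛_Ũ` of the
Guillod–Šverák profile, nothing about Leray–Hopf non-uniqueness, and it does not discharge any of the cell's paper-level
hypotheses (LEMMA C′, LEMMA Y, LEMMA Q1 — see GAPS.md G-B gen 15). It kernel-checks the LOGICAL CHAIN of the cell's conditional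
verdict "DET-2pd ⇒ a real eigenvalue of `𝓛_Ũ|anti2` in `(z₋, z₊)`" (STATUS gen 14; DET2D-HYPOTHESES.md H1–H5; LEMMAS-v13 L4),
which until now was a paper argument quoting "Kato IV §6 + continuity + IVT":

THE CHAIN. Data (`WindowInverse`): a real pencil `L, J : V →ₗ[ℝ] E` (`V` the domain, `E` a real normed space), packets
`w : ι → E`, bounded functionals `g : ι → E →L[ℝ] ℝ`, a coefficient matrix `S`, a window `[a, b]`, and for every `z ∈ [a, b]`
a TWO-SIDED inverse datum `R z : E →ₗ[ℝ] V` of the modified pencil `G_z = L − z J + (lift w g S) J`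
(`Literature.Analysis.OperatorTheory.WeinsteinAronszajnPencil.pencilMod`) with the UNIFORM bound `‖J (R z x)‖ ≤ M ‖x‖`
(in the cell: LEMMA C′ gives `M = 1/δ′` on `[z₋, z₊]`). Then
* `apply_R_eq` — the resolvent identity `J R_{z'} x = J R_z x + (z' − z) • J R_z (J R_{z'} x)` (pure algebra: `G_z − G_{z'} =
  (z' − z) J`), hence `norm_JR_sub_le` — `‖J R_{z'} x − J R_z x‖ ≤ |z' − z| · M² ‖x‖`;
* `abs_waMatrix_sub_le`, `continuousOn_waMatrix`, **`continuousOn_waDet`** — the W–A matrix `T(z) = (g_k (J R_z w_l))_kl` is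
  Lipschitz on the window, so `z ↦ det(1 − T(z) S)` is continuous on `[a, b]`;
* **`exists_eigenvector_of_waDet_mul_neg`** — if `det(1 − T(a) S) · det(1 − T(b) S) < 0` then for some `z ∈ (a, b)` the pencil
  has a non-zero kernel vector in the domain: `∃ u : V, u ≠ 0 ∧ L u = z • J u` (intermediate value theorem + the W–A criterion
  `WeinsteinAronszajnPencil.exists_eigenvector_of_det_eq_zero`);
* **`exists_eigenvector_of_detC_mul_neg`** — the same with the cell's matrix `C(z) := S⁻¹ − T(z)` when `0 < det S`
  (`det(1 − T S) = det(S⁻¹ − T) · det S`, `det_one_sub_mul_eq`), which is the form DET2D-HYPOTHESES H3 tests;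
* entries (real inner-product space `E`): **`entry_identity`**, **`abs_entry_sub_mid_le`** — the primal–dual (dual-weighted
  residual) evaluation of one entry `⟪ψk, J (R ψl)⟫ = ⟪ψk, J xt⟫ − ⟪yt, G xt − ψl⟫ + ⟪η − ψk, J (R (G xt − ψl))⟫` from an
  approximate primal solve `xt` and an approximate dual vector `yt` with exactly known weak adjoint image `η`
  (`∀ u, ⟪yt, G u⟫ = ⟪η, J u⟫`; in the cell this hypothesis is the PAPER-LEVEL LEMMA Y), and the interval radius
  `‖η − ψk‖ · M · ‖G xt − ψl‖` (LEMMAS-v13 identity L4, previously checked on paper only).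

* coercivity (real inner-product space `E`): **`coercive_of_le`** (H2 as a theorem: `δ ‖J u‖² ≤ ⟪G_b u, J u⟫ ⇒` the same for
  every `G_z`, `z ≤ b`), **`norm_JR_le_of_coercive`** (`⇒ ‖J R_z‖ ≤ δ⁻¹`), **`WindowInverse.ofCoercive`** (two-sided inverses on
  `[a, b]` + ONE coercivity estimate at `b` ⇒ the window data with `M = δ⁻¹`; in the cell `δ = δ′(z₊)` from Stage C / LEMMA C′).

WHAT THIS SETTLES for the cell: residual R-b / GAP-v11 G2 ("the Lean dictionary between the `N × N` determinant test and an
eigenvalue of the unbounded operator") is now a kernel theorem whose hypotheses are exactly the `WindowInverse` fields + a sign;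
the cell's ERRATA-R126 E7 "W-injectivity" line is confirmed unnecessary (no hypothesis on `w`, `g` beyond boundedness of `g`).
WHAT REMAINS PAPER-LEVEL: producing a `WindowInverse` for `𝓛_Ũ|anti2` on `[z₋, z₊]` (LEMMA C′(Ũ)), the hypothesis `hη` for the
actual packets (LEMMA Y), the quadrature enclosures of the midpoint data (LEMMA Q1), and the floating-point → interval
discipline of the two engines (DET2D test protocol) — these are the cell's `conditional_on` list, unchanged.

References: T. Kato, *Perturbation theory for linear operators* (1966) IV-§6.1–6.2 [Kato1966] (through the imported module);
the adjoint error representation for linear functionals is standard (cf. M. Ainsworth, J. T. Oden, *A posteriori error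
estimation in finite element analysis* (2000) Thm 8.1; M. B. Giles, E. Süli, Acta Numerica 11 (2002) §2). All proofs here are
elementary [folklore].
-/

open scoped BigOperators Matrix
open Set

noncomputable section

namespace Summit.NavierStokesRegularity.JiaSverakCAP

namespace PencilEigenvalueWindow

open Literature.Analysis.OperatorTheory.WeinsteinAronszajnPencil

section Window

variable {V : Type*} [AddCommGroup V] [Module ℝ V]
variable {E : Type*} [NormedAddCommGroup E] [NormedSpace ℝ E]
variable {ι : Type*} [Fintype ι]

/-- The functionals as plain linear maps (the form the W–A module takes). [folklore] -/
abbrev gLin (g : ι → E →L[ℝ] ℝ) : ι → E →ₗ[ℝ] ℝ := fun k => (g k : E →ₗ[ℝ] ℝ)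

/-- Certified two-sided inverse data for the modified pencil `G_z = L − z J + (lift w g S) J` on the closed window `[a, b]`,
with a uniform resolvent bound `‖J R_z‖ ≤ M` (in the cell: supplied by LEMMA C′ with `M = 1/δ′`). [folklore] -/
structure WindowInverse (L J : V →ₗ[ℝ] E) (w : ι → E) (g : ι → E →L[ℝ] ℝ) (S : Matrix ι ι ℝ) (a b : ℝ) where
  /-- the inverse datum `R z` (only its values for `z ∈ [a, b]` are constrained) -/
  R : ℝ → (E →ₗ[ℝ] V)
  /-- `G_z (R_z x) = x` on the window -/
  right_inv : ∀ z ∈ Icc a b, ∀ x : E, pencilMod L J w (gLin g) S z (R z x) = x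
  /-- `R_z (G_z u) = u` on the window -/
  left_inv : ∀ z ∈ Icc a b, ∀ u : V, R z (pencilMod L J w (gLin g) S z u) = u
  /-- the uniform resolvent bound -/
  M : ℝ
  M_nonneg : 0 ≤ M
  bound : ∀ z ∈ Icc a b, ∀ x : E, ‖J (R z x)‖ ≤ M * ‖x‖

variable {L J : V →ₗ[ℝ] E} {w : ι → E} {g : ι → E →L[ℝ] ℝ} {S : Matrix ι ι ℝ} {a b : ℝ}

/-- The W–A matrix `T(z)_{kl} = g_k (J (R_z w_l))` along the window. [folklore] -/
def T (D : WindowInverse L J w g S a b) (z : ℝ) : Matrix ι ι ℝ := waMatrix J (D.R z) w (gLin g)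

/-- The W–A determinant `det(1 − T(z) S)` along the window. [folklore] -/
def waDet [DecidableEq ι] (D : WindowInverse L J w g S a b) (z : ℝ) : ℝ := (1 - T D z * S).det

/-- Entries of `T(z)`. [folklore] -/
@[simp] lemma T_apply (D : WindowInverse L J w g S a b) (z : ℝ) (k l : ι) : T D z k l = g k (J (D.R z (w l))) := rfl

/-- `G_z u − G_{z'} u = (z' − z) • J u`: the modified pencils at two parameters differ by a multiple of `J`. [folklore] -/
lemma pencilMod_sub (z z' : ℝ) (u : V) :
    pencilMod L J w (gLin g) S z u - pencilMod L J w (gLin g) S z' u = (z' - z) • J u := by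
  rw [pencilMod_apply, pencilMod_apply, sub_smul]
  abel

/-- **Resolvent identity** on the window: `R_{z'} x = R_z x + (z' − z) • R_z (J (R_{z'} x))`. [folklore] -/
lemma R_eq (D : WindowInverse L J w g S a b) {z z' : ℝ} (hz : z ∈ Icc a b) (hz' : z' ∈ Icc a b) (x : E) :
    D.R z' x = D.R z x + (z' - z) • D.R z (J (D.R z' x)) := by
  have h1 : pencilMod L J w (gLin g) S z (D.R z' x) = x + (z' - z) • J (D.R z' x) := by
    have h := pencilMod_sub (L := L) (J := J) (w := w) (g := g) (S := S) z z' (D.R z' x)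
    rw [D.right_inv z' hz' x] at h
    rw [← h]
    abel
  have h2 := D.left_inv z hz (D.R z' x)
  rw [h1, map_add, map_smul] at h2
  exact h2.symm

/-- The resolvent identity after `J`: `J R_{z'} x = J R_z x + (z' − z) • J R_z (J R_{z'} x)`. [folklore] -/
lemma apply_R_eq (D : WindowInverse L J w g S a b) {z z' : ℝ} (hz : z ∈ Icc a b) (hz' : z' ∈ Icc a b) (x : E) :
    J (D.R z' x) = J (D.R z x) + (z' - z) • J (D.R z (J (D.R z' x))) := by
  conv_lhs => rw [R_eq D hz hz' x]
  rw [map_add, map_smul]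

/-- Lipschitz bound `‖J R_{z'} x − J R_z x‖ ≤ |z' − z| · M · M · ‖x‖` on the window. [folklore] -/
lemma norm_JR_sub_le (D : WindowInverse L J w g S a b) {z z' : ℝ} (hz : z ∈ Icc a b) (hz' : z' ∈ Icc a b)
    (x : E) : ‖J (D.R z' x) - J (D.R z x)‖ ≤ |z' - z| * (D.M * (D.M * ‖x‖)) := by
  rw [apply_R_eq D hz hz' x, add_sub_cancel_left, norm_smul, Real.norm_eq_abs]
  refine mul_le_mul_of_nonneg_left ?_ (abs_nonneg _)
  exact (D.bound z hz _).trans (mul_le_mul_of_nonneg_left (D.bound z' hz' x) D.M_nonneg)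

/-- Lipschitz bound for the entries of the W–A matrix along the window:
`|T(z')_{kl} − T(z)_{kl}| ≤ ‖g_k‖ · M² ‖w_l‖ · |z' − z|`. [folklore] -/
lemma abs_T_sub_le (D : WindowInverse L J w g S a b) {z z' : ℝ} (hz : z ∈ Icc a b) (hz' : z' ∈ Icc a b)
    (k l : ι) : |T D z' k l - T D z k l| ≤ ‖g k‖ * (D.M * (D.M * ‖w l‖)) * |z' - z| := by
  rw [T_apply, T_apply, ← map_sub, ← Real.norm_eq_abs]
  calc ‖g k (J (D.R z' (w l)) - J (D.R z (w l)))‖ ≤ ‖g k‖ * ‖J (D.R z' (w l)) - J (D.R z (w l))‖ :=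
        (g k).le_opNorm _
    _ ≤ ‖g k‖ * (|z' - z| * (D.M * (D.M * ‖w l‖))) :=
        mul_le_mul_of_nonneg_left (norm_JR_sub_le D hz hz' (w l)) (norm_nonneg _)
    _ = ‖g k‖ * (D.M * (D.M * ‖w l‖)) * |z' - z| := by ring

/-- Each entry of the W–A matrix is continuous on the window. [folklore] -/
lemma continuousOn_T_apply (D : WindowInverse L J w g S a b) (k l : ι) :
    ContinuousOn (fun z => T D z k l) (Icc a b) := by
  have hLip : LipschitzOnWith (Real.toNNReal (‖g k‖ * (D.M * (D.M * ‖w l‖)))) (fun z => T D z k l) (Icc a b) := by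
    refine LipschitzOnWith.of_dist_le_mul fun z' hz' z hz => ?_
    rw [Real.dist_eq, Real.dist_eq, Real.coe_toNNReal _ (by positivity [D.M_nonneg])]
    exact abs_T_sub_le D hz hz' k l
  exact hLip.continuousOn

/-- The matrix-valued map `z ↦ 1 − T(z) S` is continuous on the window (product topology). [folklore] -/
lemma continuousOn_one_sub_T_mul [DecidableEq ι] (D : WindowInverse L J w g S a b) :
    ContinuousOn (fun z => 1 - T D z * S) (Icc a b) := by
  refine continuousOn_pi.2 fun i => continuousOn_pi.2 fun j => ?_
  have h : ∀ z, (1 - T D z * S) i j = (1 : Matrix ι ι ℝ) i j - ∑ l, T D z i l * S l j := fun z => by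
    simp [Matrix.mul_apply]
  simp_rw [h]
  exact continuousOn_const.sub (continuousOn_finsetSum _ fun l _ => (continuousOn_T_apply D i l).mul continuousOn_const)

/-- **The W–A determinant `z ↦ det(1 − T(z) S)` is continuous on the window.** [folklore] -/
theorem continuousOn_waDet [DecidableEq ι] (D : WindowInverse L J w g S a b) : ContinuousOn (waDet D) (Icc a b) :=
  (continuous_id.matrix_det).comp_continuousOn (continuousOn_one_sub_T_mul D)

/-- A continuous real function with `f a · f b < 0` vanishes somewhere in `(a, b)`. [folklore] -/
lemma exists_Ioo_eq_zero_of_mul_neg {f : ℝ → ℝ} (hf : ContinuousOn f (Icc a b)) (hab : a ≤ b)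
    (hs : f a * f b < 0) : ∃ z ∈ Ioo a b, f z = 0 := by
  have hfa : f a ≠ 0 := fun h => by simp [h] at hs
  have hfb : f b ≠ 0 := fun h => by simp [h] at hs
  obtain ⟨z, hz, hz0⟩ : ∃ z ∈ Icc a b, f z = 0 := by
    rcases mul_neg_iff.mp hs with ⟨ha, hb⟩ | ⟨ha, hb⟩
    · exact intermediate_value_Icc' hab hf ⟨hb.le, ha.le⟩
    · exact intermediate_value_Icc hab hf ⟨ha.le, hb.le⟩
  refine ⟨z, ⟨lt_of_le_of_ne hz.1 ?_, lt_of_le_of_ne hz.2 ?_⟩, hz0⟩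
  · rintro rfl; exact hfa hz0
  · rintro rfl; exact hfb hz0

/-- **Main chain.** A sign change of the W–A determinant `det(1 − T(z) S)` between the window's end points forces a
parameter `z ∈ (a, b)` at which the pencil `L − z J` has a non-zero kernel vector in the domain `V` (for the cell: a real
eigenvalue of `L` with eigenvector in `dom ∩ anti2`). Hypotheses: the `WindowInverse` data and the sign only. [folklore] -/
theorem exists_eigenvector_of_waDet_mul_neg [DecidableEq ι] (D : WindowInverse L J w g S a b) (hab : a ≤ b)
    (hsign : waDet D a * waDet D b < 0) : ∃ z ∈ Ioo a b, ∃ u : V, u ≠ 0 ∧ L u = z • J u := by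
  obtain ⟨z, hz, hz0⟩ := exists_Ioo_eq_zero_of_mul_neg (continuousOn_waDet D) hab hsign
  exact ⟨z, hz, exists_eigenvector_of_det_eq_zero L J w (gLin g) S z (D.R z)
    (D.right_inv z (Ioo_subset_Icc_self hz)) hz0⟩

/-- `det(1 − T S) = det(S⁻¹ − T) · det S` when `det S` is a unit. [folklore] -/
lemma det_one_sub_mul_eq [DecidableEq ι] (T' S' : Matrix ι ι ℝ) (hS : IsUnit S'.det) :
    (1 - T' * S').det = (S'⁻¹ - T').det * S'.det := by
  rw [← Matrix.det_mul, Matrix.sub_mul, Matrix.nonsing_inv_mul _ hS]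

/-- **Main chain, `C(z)`-form** (DET2D-HYPOTHESES H3): with `0 < det S`, a sign change of `det C(z)`, `C(z) := S⁻¹ − T(z)`,
between the end points forces a kernel vector of the pencil at some `z ∈ (a, b)`. [folklore] -/
theorem exists_eigenvector_of_detC_mul_neg [DecidableEq ι] (D : WindowInverse L J w g S a b) (hab : a ≤ b) (hS : 0 < S.det)
    (hsign : (S⁻¹ - T D a).det * (S⁻¹ - T D b).det < 0) :
    ∃ z ∈ Ioo a b, ∃ u : V, u ≠ 0 ∧ L u = z • J u := by
  refine exists_eigenvector_of_waDet_mul_neg D hab ?_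
  have hu : IsUnit S.det := isUnit_iff_ne_zero.mpr hS.ne'
  rw [waDet, waDet, det_one_sub_mul_eq _ _ hu, det_one_sub_mul_eq _ _ hu]
  have h2 : 0 < S.det * S.det := mul_pos hS hS
  nlinarith [mul_pos_iff.mp h2]

end Window

section Entries

open scoped RealInnerProductSpace

variable {V : Type*} [AddCommGroup V] [Module ℝ V]
variable {E : Type*} [NormedAddCommGroup E] [InnerProductSpace ℝ E]

/-- **Primal–dual evaluation of one W–A matrix entry** (LEMMAS-v13 L4). `G : V →ₗ E` with two-sided inverse datum `R`;
`xt` an approximate solution of `G x = ψl` (residual `G xt − ψl`); `yt` an approximate dual vector with exactly known weak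
adjoint image `η`, i.e. `⟪yt, G u⟫ = ⟪η, J u⟫` for all `u` (the cell's LEMMA Y); dual residual `η − ψk`. Then
`⟪ψk, J (R ψl)⟫ = ⟪ψk, J xt⟫ − ⟪yt, G xt − ψl⟫ + ⟪η − ψk, J (R (G xt − ψl))⟫`. [folklore] -/
theorem entry_identity (G J : V →ₗ[ℝ] E) (R : E →ₗ[ℝ] V) (hR₁ : ∀ x, G (R x) = x) (hR₂ : ∀ u, R (G u) = u)
    (ψk ψl yt η : E) (xt : V) (hη : ∀ u : V, ⟪yt, G u⟫ = ⟪η, J u⟫) :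
    ⟪ψk, J (R ψl)⟫ = ⟪ψk, J xt⟫ - ⟪yt, G xt - ψl⟫ + ⟪η - ψk, J (R (G xt - ψl))⟫ := by
  have h1 : R (G xt - ψl) = xt - R ψl := by rw [map_sub, hR₂]
  have h2 : ⟪η, J (R (G xt - ψl))⟫ = ⟪yt, G xt - ψl⟫ := by rw [← hη, hR₁]
  rw [inner_sub_left, h2, h1, map_sub]
  simp only [inner_sub_right]
  ring

/-- **Interval radius of an entry**: with `‖J (R x)‖ ≤ M ‖x‖`, the computable midpoint `⟪ψk, J xt⟫ − ⟪yt, G xt − ψl⟫` is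
within `‖η − ψk‖ · (M · ‖G xt − ψl‖)` of `⟪ψk, J (R ψl)⟫`. [folklore] -/
theorem abs_entry_sub_mid_le (G J : V →ₗ[ℝ] E) (R : E →ₗ[ℝ] V) (hR₁ : ∀ x, G (R x) = x)
    (hR₂ : ∀ u, R (G u) = u) (ψk ψl yt η : E) (xt : V) (hη : ∀ u : V, ⟪yt, G u⟫ = ⟪η, J u⟫)
    {M : ℝ} (hM : ∀ x, ‖J (R x)‖ ≤ M * ‖x‖) :
    |⟪ψk, J (R ψl)⟫ - (⟪ψk, J xt⟫ - ⟪yt, G xt - ψl⟫)| ≤ ‖η - ψk‖ * (M * ‖G xt - ψl‖) := by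
  rw [entry_identity G J R hR₁ hR₂ ψk ψl yt η xt hη, add_sub_cancel_left]
  exact (abs_real_inner_le_norm _ _).trans (mul_le_mul_of_nonneg_left (hM _) (norm_nonneg _))

end Entries

section Coercive

/-! ### Coercivity ⇒ the window data (the abstract content of LEMMA C′ H1-norm-part and of H2 monotonicity)
In the cell, Stage C / LEMMA C′ gives ONE coercivity estimate `δ′ ‖u‖² ≤ ⟨G_{z₊} u, u⟩` at the right end point `z₊` (plus the
existence of the two-sided inverses, which is the functional-analytic content and stays a hypothesis here). Coercivity then
PROPAGATES to every `z ≤ z₊` with the same constant (`coercive_of_le`, this is H2), and yields the resolvent bound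
`‖J R_z‖ ≤ 1/δ′` (`norm_JR_le_of_coercive`), so `WindowInverse.ofCoercive` builds the window data with `M = δ′⁻¹`. -/

open scoped RealInnerProductSpace

variable {V : Type*} [AddCommGroup V] [Module ℝ V]
variable {E : Type*} [NormedAddCommGroup E] [InnerProductSpace ℝ E]
variable {ι : Type*} [Fintype ι]
variable {L J : V →ₗ[ℝ] E} {w : ι → E} {g : ι → E →L[ℝ] ℝ} {S : Matrix ι ι ℝ} {a b : ℝ}

/-- **H2 as a theorem.** Coercivity propagates to the left along the pencil: if `δ ‖J u‖² ≤ ⟪G_b u, J u⟫` for all `u`, then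
the same holds for `G_z`, every `z ≤ b` (because `G_z u = G_b u + (b − z) • J u`). [folklore] -/
theorem coercive_of_le {δ : ℝ} (hb : ∀ u : V, δ * ‖J u‖ ^ 2 ≤ ⟪pencilMod L J w (gLin g) S b u, J u⟫) {z : ℝ}
    (hz : z ≤ b) (u : V) : δ * ‖J u‖ ^ 2 ≤ ⟪pencilMod L J w (gLin g) S z u, J u⟫ := by
  have h : pencilMod L J w (gLin g) S z u = pencilMod L J w (gLin g) S b u + (b - z) • J u := by
    rw [← pencilMod_sub (L := L) (J := J) (w := w) (g := g) (S := S) z b u]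
    abel
  rw [h, inner_add_left, real_inner_smul_left]
  have h2 : 0 ≤ (b - z) * ⟪J u, J u⟫ := mul_nonneg (sub_nonneg.2 hz) real_inner_self_nonneg
  linarith [hb u]

/-- **H1, norm part.** Coercivity `δ ‖J u‖² ≤ ⟪G u, J u⟫` (`δ > 0`) and `G (R x) = x` give the resolvent bound
`‖J (R x)‖ ≤ δ⁻¹ ‖x‖`. [folklore] -/
theorem norm_JR_le_of_coercive {G : V →ₗ[ℝ] E} {R : E →ₗ[ℝ] V} {δ : ℝ} (hδ : 0 < δ)
    (hcoer : ∀ u : V, δ * ‖J u‖ ^ 2 ≤ ⟪G u, J u⟫) (hR : ∀ x, G (R x) = x) (x : E) :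
    ‖J (R x)‖ ≤ δ⁻¹ * ‖x‖ := by
  have h1 := hcoer (R x)
  rw [hR] at h1
  have h2 : ⟪x, J (R x)⟫ ≤ ‖x‖ * ‖J (R x)‖ := real_inner_le_norm _ _
  rw [inv_mul_eq_div, le_div_iff₀ hδ]
  by_cases h0 : ‖J (R x)‖ = 0
  · rw [h0, zero_mul]; exact norm_nonneg _
  · have hpos : 0 < ‖J (R x)‖ := lt_of_le_of_ne (norm_nonneg _) (Ne.symm h0)
    nlinarith

/-- **`WindowInverse` from coercivity at the right end point.** Two-sided inverses `R z` of `G_z` on `[a, b]` and ONE estimate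
`δ ‖J u‖² ≤ ⟪G_b u, J u⟫` (`δ > 0`) give the window data with `M = δ⁻¹`. [folklore] -/
def WindowInverse.ofCoercive (R : ℝ → (E →ₗ[ℝ] V))
    (hright : ∀ z ∈ Icc a b, ∀ x : E, pencilMod L J w (gLin g) S z (R z x) = x)
    (hleft : ∀ z ∈ Icc a b, ∀ u : V, R z (pencilMod L J w (gLin g) S z u) = u) {δ : ℝ} (hδ : 0 < δ)
    (hcoer : ∀ u : V, δ * ‖J u‖ ^ 2 ≤ ⟪pencilMod L J w (gLin g) S b u, J u⟫) : WindowInverse L J w g S a b where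
  R := R
  right_inv := hright
  left_inv := hleft
  M := δ⁻¹
  M_nonneg := (inv_pos.2 hδ).le
  bound := fun z hz x => norm_JR_le_of_coercive hδ (coercive_of_le hcoer hz.2) (hright z hz) x

/-- The resolvent constant of `WindowInverse.ofCoercive` is `δ⁻¹`. [folklore] -/
@[simp] lemma WindowInverse.ofCoercive_M (R : ℝ → (E →ₗ[ℝ] V))
    (hright : ∀ z ∈ Icc a b, ∀ x : E, pencilMod L J w (gLin g) S z (R z x) = x)
    (hleft : ∀ z ∈ Icc a b, ∀ u : V, R z (pencilMod L J w (gLin g) S z u) = u) {δ : ℝ} (hδ : 0 < δ)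
    (hcoer : ∀ u : V, δ * ‖J u‖ ^ 2 ≤ ⟪pencilMod L J w (gLin g) S b u, J u⟫) :
    (WindowInverse.ofCoercive R hright hleft hδ hcoer).M = δ⁻¹ := rfl

end Coercive

end PencilEigenvalueWindow

end Summit.NavierStokesRegularity.JiaSverakCAP

end
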